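import Summits.NavierStokesRegularity.NavierStokesRegularity.Theorems.PoloidalWindowDoorPoloidalWindowRigidityZShockCompactDisturbance
import Summits.NavierStokesRegularity.NavierStokesRegularity.Theorems.PoloidalWindowDoorPoloidalWindowRigidityZShockQuietTools
import HarnessLib

/-!
# Crux K2 `PoloidalWindowRigidity` (stmt-NavierStokesRegularity-19708), line `z_shock` — ★ R2 WITHOUT ANY SIGN HYPOTHESIS FOR
# SOLUTIONS WHOSE SECOND UNKNOWN `p` SETTLES TO A CONSTANT AT ONE HEIGHT END

`--supports stmt-NavierStokesRegularity-19708 --as helper` (leafhand-ns-poloidalwindowdoor-3 g3, cell decomp-ns, 2026-08-31).  Class-free,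
Mathlib + tree files only.  **No stub and no summit is closed by this file; Navier–Stokes regularity is NOT proved here (rung 0).**

Companion of `…ZShockQuietFuture` (p824147: `w(z,·) → w∞` uniformly at one height end ⇒ constant).  Here the OTHER unknown is quiet:
`pSystem_const_of_quiet_future_p` — `(w, p)` differentiable, two-sided solution of `p_z = −κ(w)² w_x`, `w_z = −p_x` on `ℝ × ℝ`,
`0 < κlo ≤ κ(w) ≤ κhi`, `|κ'(w)| ≤ k₁`, `|w_x| ≤ W₁` along the solution, `κ > 0`, `κ ∈ C¹` nowhere linearly degenerate, NO sign hypothesis;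
if `p(z, ·) → p∞` UNIFORMLY in `x` as `z → +∞`, the solution is constant; `pSystem_const_of_quiet_past_p` is the twin for `z → −∞`.
With p824147 and the transport identities (`r`, `s` constant along their characteristics, so `r`- or `s`-quietness at a height end is
trivially rigid) this settles: ANY ONE of `w, p, r, s` settling uniformly to a constant at ONE height end forces a constant state.

Proof (Riccati-free, as in p824147, with LOCAL gap control).  Along the forward characteristic `Xᵢ` from `(0, xᵢ)`: `r ≡ r(0,xᵢ)`, so
`s(z, Xᵢ z) = 2p(z, Xᵢ z) − r(0, xᵢ) → Lᵢ = 2p∞ − r(0, xᵢ)` and `K(w(z, Xᵢ z)) = r(0, xᵢ) − p(z, Xᵢ z)`.  The range of `w` is an interval on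
which `κlo ≤ K' = κ` and `|κ'| ≤ k₁`, so the gap `g = X₁ − X₀ ≥ 0` (`x₀ ≤ x₁`, ODE ordering) has
`g' = κ(w∘X₁) − κ(w∘X₀) ≤ (k₁/κlo)(|r(0,x₁) − r(0,x₀)| + |p∘X₁ − p∞| + |p∘X₀ − p∞|)`, which is eventually `≤ κlo` provided
`|r(0,x₁) − r(0,x₀)| < δ₀ := κlo²/(2(k₁+1))`.  Then the backward characteristic through `(z, X₀ z)` meets `X₁` at a height
`t* ≥ z − g(z)/(2κlo) → ∞`, `s(z, X₀ z) = s(t*, X₁ t*)`, so `L₀ = L₁`, i.e. `r(0, x₀) = r(0, x₁)`.  Hence `r(0,·)` is locally constant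
(continuity supplies `|r(0,x₁) − r(0,x₀)| < δ₀` nearby), so constant (clopen), `r` is constant on `ℝ × ℝ`, the solution is forward-flat and
`…ZShockScalarEternal.pSystem_const_of_forward_flat` finishes. [folklore]
-/

noncomputable section

namespace Summit.NavierStokesRegularity.NavierStokesRegularity.Theorems.PoloidalWindowDoorPoloidalWindowRigidityZShockQuietFutureP

-- the summit and its single sub-problem share the name (CONVENTIONS §1)
set_option linter.dupNamespace false

open Set Filter Topology Function Metric
open scoped NNReal
open Summit.NavierStokesRegularity.NavierStokesRegularity.Theorems.PoloidalWindowDoorPoloidalWindowRigidityZShockPSystemNonuniform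
open Summit.NavierStokesRegularity.NavierStokesRegularity.Theorems.PoloidalWindowDoorPoloidalWindowRigidityZShockScalarEternal
open Summit.NavierStokesRegularity.NavierStokesRegularity.Theorems.PoloidalWindowDoorPoloidalWindowRigidityZShockQuietTools

variable {w p : ℝ × ℝ → ℝ} {κ κ' K : ℝ → ℝ} {κlo κhi k₁ W₁ pinf : ℝ}

/-- **★ R2 without sign hypothesis, `p` quiet at the future height end** (hypotheses and proof in the module docstring). [folklore] -/
theorem pSystem_const_of_quiet_future_p (hw : Differentiable ℝ w) (hp : Differentiable ℝ p)
    (hKd : ∀ v, HasDerivAt K (κ v) v) (hκd : ∀ v, HasDerivAt κ (κ' v) v)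
    (hsys1 : ∀ q, fderiv ℝ p q (1, 0) = -(κ (w q) ^ 2 * fderiv ℝ w q (0, 1)))
    (hsys2 : ∀ q, fderiv ℝ w q (1, 0) = -fderiv ℝ p q (0, 1))
    (hκlo0 : 0 < κlo) (hκlo : ∀ q, κlo ≤ κ (w q)) (hκhi : ∀ q, κ (w q) ≤ κhi)
    (hκpos : ∀ v, 0 < κ v) (hgn : ∀ a b : ℝ, a < b → ∃ v ∈ Ioo a b, κ' v ≠ 0)
    (hk₁ : ∀ q, |κ' (w q)| ≤ k₁) (hW₁ : ∀ q, |fderiv ℝ w q (0, 1)| ≤ W₁)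
    (hTop : ∀ ε > 0, ∃ Z : ℝ, ∀ z x : ℝ, Z ≤ z → |p (z, x) - pinf| < ε) :
    ∀ q q' : ℝ × ℝ, w q = w q' ∧ p q = p q' := by
  have hκc : Continuous κ := continuous_iff_continuousAt.2 fun v => (hκd v).continuousAt
  have hKc : Continuous K := continuous_iff_continuousAt.2 fun v => (hKd v).continuousAt
  have hκB : ∀ q, |κ (w q)| ≤ κhi := fun q => by rw [abs_of_pos (hκpos _)]; exact hκhi q
  have hk₁0 : 0 ≤ k₁ := (abs_nonneg _).trans (hk₁ (0, 0))
  -- Riemann invariants and the two transport equations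
  set r : ℝ × ℝ → ℝ := fun q => p q + K (w q) with hrdef
  set s : ℝ × ℝ → ℝ := fun q => p q - K (w q) with hsdef
  have hKw : ∀ q, HasFDerivAt (fun q' => K (w q')) (κ (w q) • fderiv ℝ w q) q :=
    fun q => (hKd (w q)).comp_hasFDerivAt q (hw q).hasFDerivAt
  have hrF : ∀ q, HasFDerivAt r (fderiv ℝ p q + κ (w q) • fderiv ℝ w q) q := fun q => (hp q).hasFDerivAt.add (hKw q)
  have hsF : ∀ q, HasFDerivAt s (fderiv ℝ p q - κ (w q) • fderiv ℝ w q) q := fun q => (hp q).hasFDerivAt.sub (hKw q)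
  have hr1 : Differentiable ℝ r := fun q => (hrF q).differentiableAt
  have hs1 : Differentiable ℝ s := fun q => (hsF q).differentiableAt
  have hrD : ∀ q v, fderiv ℝ r q v = fderiv ℝ p q v + κ (w q) * fderiv ℝ w q v := by
    intro q v; rw [(hrF q).fderiv]; simp [smul_eq_mul]
  have hsD : ∀ q v, fderiv ℝ s q v = fderiv ℝ p q v - κ (w q) * fderiv ℝ w q v := by
    intro q v; rw [(hsF q).fderiv]; simp [smul_eq_mul]
  have hPDE1 : ∀ q, fderiv ℝ r q (1, 0) + (fun q => κ (w q)) q * fderiv ℝ r q (0, 1) = 0 := by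
    intro q; simp only; rw [hrD, hrD, hsys1, hsys2]; ring
  have hPDE2 : ∀ q, fderiv ℝ s q (1, 0) + (fun q => -κ (w q)) q * fderiv ℝ s q (0, 1) = 0 := by
    intro q; simp only; rw [hsD, hsD, hsys1, hsys2]; ring
  have hκd' : ∀ v, HasDerivAt (fun v => -κ v) ((fun v => -κ' v) v) v := fun v => (hκd v).neg
  have hκB' : ∀ q, |(fun v => -κ v) (w q)| ≤ κhi := fun q => by simp only [abs_neg]; exact hκB q
  have hk₁' : ∀ q, |(fun v => -κ' v) (w q)| ≤ k₁ := fun q => by simp only [abs_neg]; exact hk₁ q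
  -- the forward speed field is uniformly Lipschitz in `x` (for the ordering of characteristics)
  have hκw : ∀ q, HasFDerivAt (fun q' => κ (w q')) (κ' (w q) • fderiv ℝ w q) q :=
    fun q => (hκd (w q)).comp_hasFDerivAt q (hw q).hasFDerivAt
  have hLip : ∀ z, LipschitzWith (k₁ * W₁).toNNReal (fun x : ℝ => κ (w (z, x))) := by
    intro z
    have hsl : ∀ x, HasDerivAt (fun x' : ℝ => κ (w (z, x'))) (κ' (w (z, x)) * fderiv ℝ w (z, x) (0, 1)) x := by
      intro x
      have hγ : HasDerivAt (fun x' : ℝ => ((z, x') : ℝ × ℝ)) ((0 : ℝ), (1 : ℝ)) x :=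
        (hasDerivAt_const x z).prodMk (hasDerivAt_id x)
      have h := (hκw (z, x)).comp_hasDerivAt x hγ
      exact h.congr_deriv (by simp [smul_eq_mul])
    refine lipschitzWith_of_nnnorm_deriv_le (fun x => (hsl x).differentiableAt) fun x => ?_
    rw [(hsl x).deriv, ← NNReal.coe_le_coe, coe_nnnorm, Real.norm_eq_abs, abs_mul]
    refine le_trans ?_ (Real.le_coe_toNNReal _)
    exact mul_le_mul (hk₁ (z, x)) (hW₁ (z, x)) (abs_nonneg _) ((abs_nonneg _).trans (hk₁ (z, x)))
  -- the range of `w` is an interval, on which `K' = κ ≥ κlo` and `|κ'| ≤ k₁`: two mean-value estimates between values of `w`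
  have hordI : OrdConnected (range w) := isPreconnected_iff_ordConnected.1 (isPreconnected_range hw.continuous)
  have hmvt : ∀ q₀ q₁ : ℝ × ℝ, w q₀ < w q₁ →
      κlo * (w q₁ - w q₀) ≤ K (w q₁) - K (w q₀) ∧ |κ (w q₁) - κ (w q₀)| ≤ k₁ * (w q₁ - w q₀) := by
    intro q₀ q₁ hlt
    have hsub : Icc (w q₀) (w q₁) ⊆ range w := hordI.out (mem_range_self q₀) (mem_range_self q₁)
    constructor
    · obtain ⟨ξ, hξ, hξd⟩ := exists_hasDerivAt_eq_slope K κ hlt hKc.continuousOn (fun v _ => hKd v)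
      obtain ⟨qξ, hqξ⟩ := hsub (Ioo_subset_Icc_self hξ)
      have h1 : κlo ≤ κ ξ := by rw [← hqξ]; exact hκlo qξ
      rw [hξd, le_div_iff₀ (sub_pos.2 hlt)] at h1
      exact h1
    · obtain ⟨ξ, hξ, hξd⟩ := exists_hasDerivAt_eq_slope κ κ' hlt hκc.continuousOn (fun v _ => hκd v)
      obtain ⟨qξ, hqξ⟩ := hsub (Ioo_subset_Icc_self hξ)
      have h1 : |κ' ξ| ≤ k₁ := by rw [← hqξ]; exact hk₁ qξ
      have hne0 : w q₁ - w q₀ ≠ 0 := sub_ne_zero.2 hlt.ne'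
      have h2 : κ (w q₁) - κ (w q₀) = κ' ξ * (w q₁ - w q₀) := by
        rw [hξd]; field_simp
      rw [h2, abs_mul, abs_of_pos (sub_pos.2 hlt)]
      exact mul_le_mul_of_nonneg_right h1 (sub_pos.2 hlt).le
  have hspeed : ∀ q₀ q₁ : ℝ × ℝ, |κ (w q₁) - κ (w q₀)| ≤ k₁ / κlo * |K (w q₁) - K (w q₀)| := by
    intro q₀ q₁
    rcases lt_trichotomy (w q₀) (w q₁) with h | h | h
    · obtain ⟨h1, h2⟩ := hmvt q₀ q₁ h
      have h3 : |K (w q₁) - K (w q₀)| = K (w q₁) - K (w q₀) := abs_of_pos (by nlinarith [sub_pos.2 h])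
      rw [h3]
      calc |κ (w q₁) - κ (w q₀)| ≤ k₁ * (w q₁ - w q₀) := h2
        _ ≤ k₁ * ((K (w q₁) - K (w q₀)) / κlo) := by
            refine mul_le_mul_of_nonneg_left ?_ hk₁0
            rw [le_div_iff₀ hκlo0]; linarith
        _ = k₁ / κlo * (K (w q₁) - K (w q₀)) := by ring
    · rw [h]; simp
    · obtain ⟨h1, h2⟩ := hmvt q₁ q₀ h
      have h3 : |K (w q₁) - K (w q₀)| = K (w q₀) - K (w q₁) := by
        rw [abs_sub_comm]; exact abs_of_pos (by nlinarith [sub_pos.2 h])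
      rw [h3, abs_sub_comm]
      calc |κ (w q₀) - κ (w q₁)| ≤ k₁ * (w q₀ - w q₁) := h2
        _ ≤ k₁ * ((K (w q₀) - K (w q₁)) / κlo) := by
            refine mul_le_mul_of_nonneg_left ?_ hk₁0
            rw [le_div_iff₀ hκlo0]; linarith
        _ = k₁ / κlo * (K (w q₀) - K (w q₁)) := by ring
  -- (1)–(3): nearby values of `r(0,·)` coincide
  set δ₀ : ℝ := κlo ^ 2 / (2 * (k₁ + 1)) with hδ₀
  have hδ₀pos : 0 < δ₀ := by rw [hδ₀]; positivity
  have hkey : ∀ x₀ x₁ : ℝ, x₀ ≤ x₁ → |r (0, x₁) - r (0, x₀)| < δ₀ → r (0, x₀) = r (0, x₁) := by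
    intro x₀ x₁ hx hclose
    obtain ⟨X₀, hX00, hX0⟩ := exists_global_char hw hκd hκB hk₁ hW₁ 0 x₀
    obtain ⟨X₁, hX10, hX1⟩ := exists_global_char hw hκd hκB hk₁ hW₁ 0 x₁
    have hrX : ∀ (X : ℝ → ℝ) (x : ℝ), X 0 = x → (∀ z, HasDerivAt X (κ (w (z, X z))) z) → ∀ z, r (z, X z) = r (0, x) := by
      intro X x hX0' hX z
      have h := const_along (c := fun q => κ (w q)) hr1 hPDE1 hX z 0
      rwa [hX0'] at h
    have hsr : ∀ q, s q = 2 * p q - r q := fun q => by simp only [hrdef, hsdef]; ring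
    have hKr : ∀ q, K (w q) = r q - p q := fun q => by simp only [hrdef]; ring
    -- `p ∘ X → pinf`, hence `s ∘ X → 2 pinf − r(0, x)`, for both characteristics
    have hplim : ∀ X : ℝ → ℝ, Tendsto (fun z => p (z, X z)) atTop (𝓝 pinf) := by
      intro X
      rw [Metric.tendsto_atTop]
      intro ε hε
      obtain ⟨Z, hZ⟩ := hTop ε hε
      exact ⟨Z, fun z hz => by rw [Real.dist_eq]; exact hZ z (X z) hz⟩
    have hslim : ∀ (X : ℝ → ℝ) (x : ℝ), X 0 = x → (∀ z, HasDerivAt X (κ (w (z, X z))) z) →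
        Tendsto (fun z => s (z, X z)) atTop (𝓝 (2 * pinf - r (0, x))) := by
      intro X x hX0' hX
      have h2 := ((hplim X).const_mul 2).sub (tendsto_const_nhds (x := r (0, x)))
      refine h2.congr fun z => ?_
      rw [hsr, hrX X x hX0' hX z]
    have hL0 := hslim X₀ x₀ hX00 hX0
    have hL1 := hslim X₁ x₁ hX10 hX1
    -- (2) ordering and LOCAL gap control
    have hord : ∀ z, X₀ z ≤ X₁ z :=
      le_of_le_char (F := fun z x => κ (w (z, x))) hLip hX0 hX1 (z₀ := 0) (by rw [hX00, hX10]; exact hx)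
    set g : ℝ → ℝ := fun z => X₁ z - X₀ z with hg
    have hgd : ∀ z, HasDerivAt g (κ (w (z, X₁ z)) - κ (w (z, X₀ z))) z := fun z => (hX1 z).sub (hX0 z)
    have hg0 : ∀ z, 0 ≤ g z := fun z => by simp only [hg]; linarith [hord z]
    obtain ⟨Z, hZ⟩ : ∃ Z : ℝ, ∀ z, Z ≤ z → κ (w (z, X₁ z)) - κ (w (z, X₀ z)) ≤ κlo := by
      obtain ⟨Z, hZ⟩ := hTop (δ₀ / 2) (by positivity)
      refine ⟨Z, fun z hz => ?_⟩
      have h1 := hZ z (X₁ z) hz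
      have h0 := hZ z (X₀ z) hz
      have hsp := hspeed (z, X₀ z) (z, X₁ z)
      have hK1 : K (w (z, X₁ z)) - K (w (z, X₀ z)) =
          (r (0, x₁) - r (0, x₀)) - (p (z, X₁ z) - pinf) + (p (z, X₀ z) - pinf) := by
        rw [hKr, hKr, hrX X₁ x₁ hX10 hX1 z, hrX X₀ x₀ hX00 hX0 z]; ring
      have hK2 : |K (w (z, X₁ z)) - K (w (z, X₀ z))| < 2 * δ₀ := by
        rw [hK1]
        calc |r (0, x₁) - r (0, x₀) - (p (z, X₁ z) - pinf) + (p (z, X₀ z) - pinf)|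
            ≤ |r (0, x₁) - r (0, x₀) - (p (z, X₁ z) - pinf)| + |p (z, X₀ z) - pinf| := abs_add_le _ _
          _ ≤ |r (0, x₁) - r (0, x₀)| + |p (z, X₁ z) - pinf| + |p (z, X₀ z) - pinf| := by
              linarith [abs_sub (r (0, x₁) - r (0, x₀)) (p (z, X₁ z) - pinf)]
          _ < δ₀ + δ₀ / 2 + δ₀ / 2 := by linarith
          _ = 2 * δ₀ := by ring
      have hkk : k₁ / κlo * (2 * δ₀) ≤ κlo := by
        rw [hδ₀]
        have : k₁ / κlo * (2 * (κlo ^ 2 / (2 * (k₁ + 1)))) = κlo * (k₁ / (k₁ + 1)) := by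
          field_simp
        rw [this]
        have hfrac : k₁ / (k₁ + 1) ≤ 1 := by rw [div_le_one (by linarith)]; linarith
        nlinarith
      have : |κ (w (z, X₁ z)) - κ (w (z, X₀ z))| ≤ κlo :=
        le_trans hsp (le_trans (mul_le_mul_of_nonneg_left hK2.le (by positivity)) hkk)
      linarith [le_abs_self (κ (w (z, X₁ z)) - κ (w (z, X₀ z)))]
    have hgrow : ∀ z, Z < z → g z ≤ g Z + κlo * (z - Z) := by
      intro z hz
      have h := slope_ge_of_deriv_ge (ψ := fun t => -g t) (β := fun t => -(κ (w (t, X₁ t)) - κ (w (t, X₀ t))))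
        (b₀ := -κlo) (fun t => (hgd t).neg) hz (fun t ht => by linarith [hZ t ht.1.le])
      linarith
    -- (3) `s (z, X₀ z)` also tends to the limit along `X₁`
    have hL1' : Tendsto (fun z => s (z, X₀ z)) atTop (𝓝 (2 * pinf - r (0, x₁))) := by
      rw [Metric.tendsto_atTop]
      intro ε hε
      obtain ⟨T₁, hT₁⟩ := Metric.tendsto_atTop.1 hL1 ε hε
      refine ⟨max Z (2 * (T₁ + g Z / (2 * κlo)) - Z) + 1, fun z hz => ?_⟩
      have hzZ : Z < z := by linarith [le_max_left Z (2 * (T₁ + g Z / (2 * κlo)) - Z)]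
      have hz2 : 2 * (T₁ + g Z / (2 * κlo)) - Z < z := by
        linarith [le_max_right Z (2 * (T₁ + g Z / (2 * κlo)) - Z)]
      obtain ⟨Y, hY0, hY⟩ := exists_global_char (c := fun v => -κ v) hw hκd' hκB' hk₁' hW₁ z (X₀ z)
      set D : ℝ → ℝ := fun t => X₁ t - Y t with hD
      have hDd : ∀ t, HasDerivAt D (κ (w (t, X₁ t)) - -κ (w (t, Y t))) t := fun t => (hX1 t).sub (hY t)
      have hDc : Continuous D := continuous_iff_continuousAt.2 fun t => (hDd t).continuousAt
      have hDz : D z = g z := by simp only [hD, hg, hY0]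
      set t₁ : ℝ := z - g z / (2 * κlo) with ht₁
      have ht₁z : t₁ ≤ z := by
        have : 0 ≤ g z / (2 * κlo) := div_nonneg (hg0 z) (by positivity)
        rw [ht₁]; linarith
      have hDt₁ : D t₁ ≤ 0 := by
        rcases ht₁z.eq_or_lt with heq | hlt
        · have hgz : g z = 0 := by
            have : g z / (2 * κlo) = 0 := by rw [ht₁] at heq; linarith
            rcases div_eq_zero_iff.1 this with h | h
            · exact h
            · exfalso; linarith
          rw [heq, hDz, hgz]
        · have h := slope_ge_of_deriv_ge (b₀ := 2 * κlo) hDd hlt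
            (fun t _ => by linarith [hκlo (t, X₁ t), hκlo (t, Y t)])
          have h2 : 2 * κlo * (z - t₁) = g z := by rw [ht₁]; field_simp; ring
          rw [hDz] at h
          linarith
      obtain ⟨tstar, hts, hDts⟩ : ∃ t ∈ Icc t₁ z, D t = 0 := by
        have h0 : (0 : ℝ) ∈ Icc (D t₁) (D z) := ⟨hDt₁, by rw [hDz]; exact hg0 z⟩
        exact intermediate_value_Icc ht₁z hDc.continuousOn h0
      have hmeet : Y tstar = X₁ tstar := by simp only [hD] at hDts; linarith
      have hsY : s (z, X₀ z) = s (tstar, X₁ tstar) := by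
        have h := const_along (c := fun q => -κ (w q)) hs1 hPDE2 hY z tstar
        rw [hY0, hmeet] at h
        exact h
      have hbig : T₁ ≤ tstar := by
        have h1 : t₁ ≤ tstar := hts.1
        have h2 := hgrow z hzZ
        have h3 : g z / (2 * κlo) ≤ (g Z + κlo * (z - Z)) / (2 * κlo) :=
          div_le_div_of_nonneg_right h2 (by positivity)
        have h4 : (g Z + κlo * (z - Z)) / (2 * κlo) = g Z / (2 * κlo) + (z - Z) / 2 := by
          field_simp
        rw [ht₁] at h1
        linarith
      rw [hsY]
      exact hT₁ tstar hbig
    have hLeq := tendsto_nhds_unique hL0 hL1'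
    linarith
  -- (4) `r(0,·)` is locally constant, hence constant (clopen), hence `r` is constant on `ℝ × ℝ`
  have hρc : Continuous fun y : ℝ => r (0, y) := hr1.continuous.comp (continuous_const.prodMk continuous_id)
  have hloc : ∀ x₀, ∃ η > 0, ∀ x, |x - x₀| < η → r (0, x) = r (0, x₀) := by
    intro x₀
    have hev : ∀ᶠ x in 𝓝 x₀, |r (0, x) - r (0, x₀)| < δ₀ := by
      have h := (hρc.continuousAt (x := x₀)).sub (continuousAt_const (y := r (0, x₀)))
      have h2 := h.norm.eventually_lt_const (show ‖r (0, x₀) - r (0, x₀)‖ < δ₀ by rw [sub_self, norm_zero]; exact hδ₀pos)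
      simpa [Real.norm_eq_abs] using h2
    obtain ⟨η, hη, hball⟩ := Metric.eventually_nhds_iff.1 hev
    refine ⟨η, hη, fun x hx => ?_⟩
    have hx' := hball (show dist x x₀ < η by rw [Real.dist_eq]; exact hx)
    rcases le_total x₀ x with h | h
    · exact (hkey x₀ x h hx').symm
    · exact hkey x x₀ h (by rw [abs_sub_comm]; exact hx')
  set Sset : Set ℝ := {x | r (0, x) = r (0, 0)} with hSset
  have hclosed : IsClosed Sset := isClosed_eq hρc continuous_const
  have hopen : IsOpen Sset := by
    rw [Metric.isOpen_iff]
    intro x hx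
    obtain ⟨η, hη, h⟩ := hloc x
    refine ⟨η, hη, fun x' hx' => ?_⟩
    have := h x' (by rwa [Metric.mem_ball, Real.dist_eq] at hx')
    show r (0, x') = r (0, 0)
    rw [this]; exact hx
  have huniv : Sset = univ := (isClopen_iff.1 ⟨hclosed, hopen⟩).resolve_left (Set.nonempty_of_mem (show (0:ℝ) ∈ Sset from rfl)).ne_empty
  have hρ : ∀ x, r (0, x) = r (0, 0) := fun x => by
    have : x ∈ Sset := by rw [huniv]; exact mem_univ x
    exact this
  have hrconst : ∀ q : ℝ × ℝ, r q = r (0, 0) := by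
    rintro ⟨z, x⟩
    obtain ⟨X, hX0, hX⟩ := exists_global_char hw hκd hκB hk₁ hW₁ z x
    have h := const_along (c := fun q => κ (w q)) hr1 hPDE1 hX z 0
    rw [hX0] at h
    rw [h, hρ]
  have hflat : ∀ q, fderiv ℝ p q (0, 1) + κ (w q) * fderiv ℝ w q (0, 1) = 0 := by
    intro q
    rw [← hrD, show r = fun _ => r (0, 0) from funext hrconst]
    simp
  exact pSystem_const_of_forward_flat hw hp hκd hsys1 hsys2 hκpos hκhi hk₁ hW₁ hgn hflat

/-- **Past-quiet twin** (`p(z, ·) → p∞` uniformly as `z → −∞` ⇒ constant), by the point reflection `(z, x) ↦ (−z, −x)`, which maps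
solutions to solutions. [folklore] -/
theorem pSystem_const_of_quiet_past_p (hw : Differentiable ℝ w) (hp : Differentiable ℝ p)
    (hKd : ∀ v, HasDerivAt K (κ v) v) (hκd : ∀ v, HasDerivAt κ (κ' v) v)
    (hsys1 : ∀ q, fderiv ℝ p q (1, 0) = -(κ (w q) ^ 2 * fderiv ℝ w q (0, 1)))
    (hsys2 : ∀ q, fderiv ℝ w q (1, 0) = -fderiv ℝ p q (0, 1))
    (hκlo0 : 0 < κlo) (hκlo : ∀ q, κlo ≤ κ (w q)) (hκhi : ∀ q, κ (w q) ≤ κhi)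
    (hκpos : ∀ v, 0 < κ v) (hgn : ∀ a b : ℝ, a < b → ∃ v ∈ Ioo a b, κ' v ≠ 0)
    (hk₁ : ∀ q, |κ' (w q)| ≤ k₁) (hW₁ : ∀ q, |fderiv ℝ w q (0, 1)| ≤ W₁)
    (hBot : ∀ ε > 0, ∃ Z : ℝ, ∀ z x : ℝ, z ≤ Z → |p (z, x) - pinf| < ε) :
    ∀ q q' : ℝ × ℝ, w q = w q' ∧ p q = p q' := by
  set w' : ℝ × ℝ → ℝ := fun q => w (-q) with hw'
  set p' : ℝ × ℝ → ℝ := fun q => p (-q) with hp'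
  have hneg : Differentiable ℝ fun q : ℝ × ℝ => -q := differentiable_id.neg
  have hw'1 : Differentiable ℝ w' := hw.comp hneg
  have hp'1 : Differentiable ℝ p' := hp.comp hneg
  have hw'D : ∀ q v, fderiv ℝ w' q v = -fderiv ℝ w (-q) v := by
    intro q v
    have h := ((hw (-q)).hasFDerivAt.comp q ((hasFDerivAt_id q).neg)).fderiv
    rw [show w' = w ∘ Neg.neg from rfl, h]
    simp
  have hp'D : ∀ q v, fderiv ℝ p' q v = -fderiv ℝ p (-q) v := by
    intro q v
    have h := ((hp (-q)).hasFDerivAt.comp q ((hasFDerivAt_id q).neg)).fderiv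
    rw [show p' = p ∘ Neg.neg from rfl, h]
    simp
  have hsys1' : ∀ q, fderiv ℝ p' q (1, 0) = -(κ (w' q) ^ 2 * fderiv ℝ w' q (0, 1)) := by
    intro q; rw [hp'D, hw'D, hsys1]; ring
  have hsys2' : ∀ q, fderiv ℝ w' q (1, 0) = -fderiv ℝ p' q (0, 1) := by
    intro q; rw [hw'D, hp'D, hsys2]
  have hTop' : ∀ ε > 0, ∃ Z : ℝ, ∀ z x : ℝ, Z ≤ z → |p' (z, x) - pinf| < ε := by
    intro ε hε
    obtain ⟨Z, hZ⟩ := hBot ε hε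
    refine ⟨-Z, fun z x hz => ?_⟩
    have h := hZ (-z) (-x) (by linarith)
    simpa [hp'] using h
  have h := pSystem_const_of_quiet_future_p hw'1 hp'1 hKd hκd hsys1' hsys2' hκlo0 (fun q => hκlo (-q))
    (fun q => hκhi (-q)) hκpos hgn (fun q => hk₁ (-q))
    (fun q => by rw [hw'D, abs_neg]; exact hW₁ (-q)) hTop'
  intro q q'
  obtain ⟨h1, h2⟩ := h (-q) (-q')
  simp only [hw', hp', neg_neg] at h1 h2
  exact ⟨h1, h2⟩

end Summit.NavierStokesRegularity.NavierStokesRegularity.Theorems.PoloidalWindowDoorPoloidalWindowRigidityZShockQuietFutureP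

end
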